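import Summits.ResolutionOfSingularities.ResolutionOfSingularities.Theorems.WeightedInvariantLocalWeightedDropWildPurePowerFlagDropZeroCompanion
import Summits.ResolutionOfSingularities.ResolutionOfSingularities.Theorems.WeightedInvariantLocalWeightedDropWildPurePowerFlagDropZeroAssembly

/-!
# `LocalWeightedDrop`, piece S3πM: [HP24, Prop. 4] case (i) at `t = 0` in the shape of `DropZeroStatement` — companion branch, SECOND
# ORIENTATION, and all residual orders at once

Crux item stmt-ResolutionOfSingularities-8899 `LocalWeightedDrop`, class stub S3πM; sub-target `PurePowerFlag.DropZeroStatement`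
(res-L1-w43-stub-1's `…FlagDropSplit.lean`).  [OURS · L1 W4.3, chain w43, seat res-D-pv-058 acting as res-L1-w43-stub-6; printed mathematics:
Hauser–Perlega, PRIMS 60 (2024) Prop. 4 proof case (i), p. 794 l. 40 – p. 795 l. 20; not a statement of any manuscript.]

* **`exists_flag_gt_of_isN0_swap_stepZero_lt`**: the child flag `V(z₁, x)` (second orientation, `g = 0` forced) in the companion branch
  `0 < d_res(B) < q`, witness the zero shift of the parent: `s(B,E,0) = s(T,E′,0) + c!` while the swapped child has `s ≤ c!` (corner `y^d`
  of `G′`, `k[[y]]` a domain), strict unless `s(T,E′,0) = 0`, where the `M`-parts decide;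
* **`exists_flag_gt_of_isN0_stepZero_all`, `exists_flag_gt_of_isN0_swap_stepZero_all`**: the `n = 0` child flags of both orientations for
  EVERY `d_res(B)` (child non-terminal; `d_res ≥ q`: p509083; `0 < d_res < q`: companion files; `d_res = 0`: impossible);
* **`dropZero_hγ₁`, `dropZero_hγ₂`**: the hypotheses `(hγ₁)`, `(hγ₂)` of res-L1-w43-stub-1's `dropZeroStatement_of_pieces` (p510442)
  VERBATIM, discharged; **`dropZeroStatement_of_iv`**: `DropZeroStatement p e k` from the single remaining piece `(iv₀)` (second-orientation
  tangent child flags of tangency `≥ 2`).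
-/

set_option linter.dupNamespace false -- mandated namespace of this single-conjunct summit

namespace Summit.ResolutionOfSingularities.ResolutionOfSingularities.Theorems

open Literature.AlgebraicGeometry.Resolution
open Literature.AlgebraicGeometry.Resolution.HauserPerlega2024

namespace PurePowerFlag

open MvPowerSeries

variable {k : Type} [Field k]

/-- the exponent `x^a y^b` at `0`. -/
private theorem w_l (a b : ℕ) : (Finsupp.single (0 : Fin 2) a + Finsupp.single (1 : Fin 2) b : Fin 2 →₀ ℕ) 0 = a := by
  rw [Finsupp.add_apply, Finsupp.single_eq_same, Finsupp.single_eq_of_ne (by decide), add_zero]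

/-- the exponent `x^a y^b` at `1`. -/
private theorem w_r (a b : ℕ) : (Finsupp.single (0 : Fin 2) a + Finsupp.single (1 : Fin 2) b : Fin 2 →₀ ℕ) 1 = b := by
  rw [Finsupp.add_apply, Finsupp.single_eq_of_ne (by decide), Finsupp.single_eq_same, zero_add]

/-- every exponent is `x^{m 0} y^{m 1}`. -/
private theorem w_ssa (m : Fin 2 →₀ ℕ) : m = Finsupp.single 0 (m 0) + Finsupp.single 1 (m 1) := by
  ext l
  rcases fin_two_cases l with rfl | rfl
  · rw [w_l]
  · rw [w_r]

/-- degree in two letters. -/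
private theorem w_deg (m : Fin 2 →₀ ℕ) : m.degree = m 0 + m 1 := by
  rw [Finsupp.degree_eq_sum, Fin.sum_univ_two]

/-- `r_x + r_y + d_res ≤ deg m` on the support. -/
private theorem w_exc_add_dRes_le {B : MvPowerSeries (Fin 2) k} (hB : B ≠ 0) (E : Finset (Fin 2)) {m : Fin 2 →₀ ℕ}
    (hm : coeff m B ≠ 0) : excExp B E 0 + excExp B E 1 + dRes B E ≤ m 0 + m 1 := by
  rw [← order_toNat_eq_excExp_add_dRes hB E]
  have h1 := MvPowerSeries.order_le hm
  rw [← (MvPowerSeries.ne_zero_iff_order_finite).mp hB, w_deg] at h1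
  exact_mod_cast h1

/-- **[HP24, Prop. 4 (i)], child flag `V(z₁, x)` (second orientation, `g = 0` forced), COMPANION BRANCH `0 < d_res(B) < q`**,
DropZeroStatement shape: witness the zero shift of the parent.  With `c = (q − d)d`: `s(B,E,0) = s(T,E′,0) + c!` (companion identity),
while the swapped child flag has `s ≤ (c!/c)·ord_y G′(0,y)^{q−d} = c!` (the corner `y^d` of `G′`, `k[[y]]` a domain) — strict unless
`s(T,E′,0) = 0`, in which case `M′^d` has a pure `y`-power row `y^{d r_y}`, `d r_y < c`, and the swapped child's `M`-part is
`(c!/c)·(d r_y) < c!`. [HP24 Prop. 4 (i) p. 794 l. 40–45 with p. 795 l. 6–20] -/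
theorem exists_flag_gt_of_isN0_swap_stepZero_lt (q : ℕ) {B T : MvPowerSeries (Fin 2) k} (hB : cleanSeries q B = B)
    (hB0 : B ≠ 0) (hqo : ((q : ℕ) : ℕ∞) ≤ B.order)
    (hT : (X 0 : MvPowerSeries (Fin 2) k) ^ q * T = subst (PlaneGerm.dirChart (0 : k)) B) {E E' : Finset (Fin 2)}
    (h0 : (0 : Fin 2) ∈ E') (h1 : (1 : Fin 2) ∈ E' ↔ (1 : Fin 2) ∈ E) (hd0 : 0 < dRes B E) (hdq : dRes B E < q)
    (g : PowerSeries k) (hN : IsN0 (swapE E') g) :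
    ∃ f : PowerSeries k, PowerSeries.constantCoeff f = 0 ∧ (IsN0 E f ∨ IsTangent E f) ∧
      flagTriple q (swap T) (swapE E') g < flagTriple q B E f := by
  classical
  have hh : g = 0 := hN.resolve_left (fun hne => hne ((mem_swapE E' 1).mpr (by rw [Equiv.swap_apply_right]; exact h0)))
  subst hh
  have hTc := cleanSeries_of_stepZero q hB hT
  have hT0 := ne_zero_stepZero q hB0 hT
  refine ⟨0, map_zero _, Or.inl (Or.inr rfl), ?_⟩
  rw [flagTriple_of_isN0 q (swap T) hN, flagTriple_of_isN0 q B (Or.inr rfl), dRes_swap, Prod.Lex.toLex_lt_toLex]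
  rcases (dRes_stepZero_le q hB0 hqo hT h0 h1).lt_or_eq with hlt' | heq
  · left; exact hlt'
  right
  refine ⟨heq, ?_⟩
  rw [Prod.Lex.toLex_lt_toLex]
  right
  refine ⟨rfl, ?_⟩
  show sFlag q (swap T) (swapE E') 0 < sFlag q B E 0
  have hT' := hT
  rw [subst_dirChart_zero_eq] at hT'
  obtain ⟨hrx, hry⟩ := excExp_stepZero q hB0 hqo hT h0 h1
  set d := dRes B E with hdd
  set rx := excExp B E 0 with hrxd
  set ry := excExp B E 1 with hryd
  set rx' := excExp T E' 0 with hrx'd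
  set c := (q - d) * d with hc
  have hcpos : 0 < c := Nat.mul_pos (by omega) hd0
  have hwpos : 0 < c.factorial / c := Nat.div_pos (Nat.self_le_factorial c) hcpos
  have hcdiv : c.factorial / c * c = c.factorial := Nat.div_mul_cancel (Nat.dvd_factorial hcpos le_rfl)
  -- the parent: `s₀ = s′₀ + c!`
  have hs0 : sFlag q T E' 0 + ((c.factorial : ℕ) : ℕ∞) = sFlag q B E 0 := by
    have := sFlag_stepZero_add_cfactorial q hB hB0 hqo hT h0 h1 hd0 hdq heq 0 (map_zero _) (Or.inr rfl)
    rwa [mul_zero] at this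
  -- the child (second orientation), companion branch
  have hdT : dRes T E' = d := heq
  rw [sFlag_eq_min q (swap T) (swapE E') 0 (by rw [dRes_swap, hdT]; omega), dRes_swap, hdT]
  -- (a) the `G`-part is at most `c!`: row `0` of `G′ₛ^{q-d}` is `G′(0,y)^{q-d}`, of order `(q-d)·d`
  set Gs := residual q (swap T) (swapE E') 0 with hGs
  have hColv : ∀ i v, coeff (Finsupp.single 0 v + Finsupp.single 1 i) Gs =
      coeff (Finsupp.single 0 (rx' + i) + Finsupp.single 1 (ry + v)) T := by
    intro i v
    have := coeff_row_residual_swap_zero q hTc E' i v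
    rw [PowerSeries.coeff_mk] at this
    rw [hGs, this, hry]
  -- the corner `y^d` of `G′`
  have hn : ∀ m, coeff m B ≠ 0 → Finsupp.single 0 rx + Finsupp.single 1 ry ≤ m := fun m hm => by
    have := excExp_le_of_coeff_ne_zero B E hm
    rwa [w_ssa (excExp B E)] at this
  obtain ⟨m₁, hm₁, hdeg₁⟩ := MvPowerSeries.exists_coeff_ne_zero_and_order ((MvPowerSeries.ne_zero_iff_order_finite).mp hB0)
  have hex : ∃ m, coeff m B ≠ 0 ∧ m 0 + m 1 = rx + ry + d := by
    refine ⟨m₁, hm₁, ?_⟩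
    rw [hrxd, hryd, hdd, ← order_toNat_eq_excExp_add_dRes hB0 E]
    have h2 : ((m₁ 0 + m₁ 1 : ℕ) : ℕ∞) = (B.order.toNat : ℕ∞) := by
      rw [← w_deg, hdeg₁, (MvPowerSeries.ne_zero_iff_order_finite).mp hB0]
    exact_mod_cast h2
  have hmin' : ∀ m, coeff m T ≠ 0 → rx' + ry + d ≤ m 0 + m 1 := fun m hm => by
    have := w_exc_add_dRes_le hT0 E' hm; rw [hry, hdT] at this; exact this
  have hcorner := corner_ne_zero_of_step_xy q 0 1 zero_ne_one_fin fin_two_cases B T hT' rx rx' ry d hrx hn hex hmin'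
    (fun j => PowerSeries.mk fun v => coeff (Finsupp.single 0 (rx + v) + Finsupp.single 1 (ry + j)) B)
    (fun j => PowerSeries.mk fun v => coeff (Finsupp.single 0 (rx' + v) + Finsupp.single 1 (ry + j)) T)
    (fun j v => by rw [PowerSeries.coeff_mk]) (fun j v => by rw [PowerSeries.coeff_mk])
  rw [PowerSeries.coeff_mk, Nat.add_zero] at hcorner
  have hrow : (PowerSeries.mk fun v => coeff (Finsupp.single 0 v + Finsupp.single 1 0) Gs).order = (d : ℕ∞) := by
    refine PowerSeries.order_eq_nat.mpr ⟨?_, fun i hi => ?_⟩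
    · rw [PowerSeries.coeff_mk, hColv, Nat.add_zero]
      exact hcorner
    · by_contra hne
      rw [PowerSeries.coeff_mk, hColv, Nat.add_zero] at hne
      have := hmin' _ hne
      rw [w_l, w_r] at this
      omega
  have hρ : ∀ H : MvPowerSeries (Fin 2) k,
      subst (fun i : Fin 2 => if i = (0 : Fin 2) then (PowerSeries.X : PowerSeries k) else 0) H =
        PowerSeries.mk fun v => coeff (Finsupp.single 0 v + Finsupp.single 1 0) H := fun H => by
    ext v
    rw [coeff_subst_rowZero, PowerSeries.coeff_mk, Finsupp.single_zero, add_zero]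
  have hGrow : rowOrder (0 : Fin 2) 1 (Gs ^ (q - d)) 0 = (c : ℕ∞) := by
    rw [rowOrder_eq_order_mk, ← hρ, subst_pow hasSubst_rowZero, hρ, PowerSeries.order_pow, hrow, nsmul_eq_mul, hc,
      Nat.cast_mul]
  have hG : coeffIdealOrder c (0 : Fin 2) 1 (Gs ^ (q - d)) ≤ ((c.factorial : ℕ) : ℕ∞) := by
    refine le_trans (coeffIdealOrder_le_row_zero hcpos _) ?_
    rw [hGrow, ← Nat.cast_mul, hcdiv]
  by_cases hs' : sFlag q T E' 0 = 0
  · -- `s′₀ = 0`: the `M′`-part of the child vanishes on a pure `y`-power row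
    rw [hs', zero_add] at hs0
    rw [← hs0]
    have hs'' := hs'
    rw [sFlag_eq_min q T E' 0 (by omega), hdT] at hs''
    have hG'pos : coeffIdealOrder c (0 : Fin 2) 1 ((residual q T E' 0) ^ (q - d)) ≠ 0 := by
      have := cfactorial_le_coeffIdealOrder_residual_pow q hTc hT0 E'
      rw [hdT] at this
      intro h0'
      rw [h0'] at this
      have : (c.factorial : ℕ) = 0 := by exact_mod_cast nonpos_iff_eq_zero.mp this
      exact (Nat.factorial_pos c).ne' this
    have hM'0 : coeffIdealOrder c (0 : Fin 2) 1 ((monomial (excExp T E') (1 : k)) ^ d) = 0 := by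
      rcases min_eq_iff.mp hs'' with ⟨h, -⟩ | ⟨h, -⟩
      · exact h
      · exact absurd h hG'pos
    rw [coeffIdealOrder_eq_inf_mk] at hM'0
    obtain ⟨i, hi, hieq⟩ := (Finset.range c).exists_mem_eq_inf ⟨0, Finset.mem_range.mpr hcpos⟩
      (fun i => ((c.factorial / (c - i) : ℕ) : ℕ∞) * (PowerSeries.mk fun v => coeff (Finsupp.single 0 v + Finsupp.single 1 i)
        ((monomial (excExp T E') (1 : k)) ^ d)).order)
    rw [hieq] at hM'0
    rw [Finset.mem_range] at hi
    have hMd : (monomial (excExp T E') (1 : k)) ^ d = monomial (d • excExp T E') 1 := by rw [monomial_pow, one_pow]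
    rcases mul_eq_zero.mp hM'0 with hw0 | hord
    · exfalso
      have hw1 : 0 < c.factorial / (c - i) := Nat.div_pos (le_trans (Nat.sub_le c i) (Nat.self_le_factorial c)) (by omega)
      have : (c.factorial / (c - i) : ℕ) = 0 := by exact_mod_cast hw0
      omega
    · have hc0 := (PowerSeries.order_eq_nat.mp hord).1
      rw [PowerSeries.coeff_mk, hMd] at hc0
      have hexp : Finsupp.single (0 : Fin 2) 0 + Finsupp.single 1 i = d • excExp T E' := by
        by_contra hne
        exact hc0 (coeff_monomial_ne hne _)
      have hx0 : d * rx' = 0 := by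
        have := congrArg (fun f => f 0) hexp
        simp only [w_l, Finsupp.smul_apply, smul_eq_mul] at this
        rw [hrx'd]; omega
      have hyi : d * ry = i := by
        have := congrArg (fun f => f 1) hexp
        simp only [w_r, Finsupp.smul_apply, smul_eq_mul] at this
        rw [← hry]; omega
      -- the swapped child's `M`-part
      have hMs : (monomial (excExp (swap T) (swapE E')) (1 : k)) ^ d = monomial (Finsupp.single 0 i + Finsupp.single 1 0) 1 := by
        have hexp' : d • excExp (swap T) (swapE E') = Finsupp.single 0 i + Finsupp.single 1 0 := by
          ext l
          rcases fin_two_cases l with hl | hl <;> rw [hl]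
          · rw [Finsupp.smul_apply, smul_eq_mul, excExp_swap_apply, Equiv.swap_apply_left, hry, w_l, hyi]
          · rw [Finsupp.smul_apply, smul_eq_mul, excExp_swap_apply, Equiv.swap_apply_right, w_r, ← hrx'd, hx0]
        rw [monomial_pow, one_pow, hexp']
      refine lt_of_le_of_lt (min_le_left _ _) ?_
      refine lt_of_le_of_lt (coeffIdealOrder_le_row_zero hcpos _) ?_
      have hrowM : rowOrder (0 : Fin 2) 1 ((monomial (excExp (swap T) (swapE E')) (1 : k)) ^ d) 0 ≤ (i : ℕ∞) := by
        rw [hMs]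
        refine rowOrder_le_of_coeff_ne_zero ?_
        rw [coeff_monomial_same]
        exact one_ne_zero
      calc ((c.factorial / c : ℕ) : ℕ∞) * rowOrder (0 : Fin 2) 1 ((monomial (excExp (swap T) (swapE E')) (1 : k)) ^ d) 0
          ≤ ((c.factorial / c : ℕ) : ℕ∞) * (i : ℕ∞) := mul_le_mul_of_nonneg_left hrowM zero_le
        _ < ((c.factorial : ℕ) : ℕ∞) := by
          rw [← Nat.cast_mul, Nat.cast_lt]
          calc c.factorial / c * i < c.factorial / c * c := Nat.mul_lt_mul_of_pos_left hi hwpos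
            _ = c.factorial := hcdiv
  · -- `s′₀ ≥ 1`: `σ ≤ c! < c! + 1 ≤ s₀`
    have h1le : (1 : ℕ∞) ≤ sFlag q T E' 0 := Order.one_le_iff_ne_zero.mpr hs'
    refine lt_of_le_of_lt (min_le_right _ _) (lt_of_le_of_lt hG ?_)
    rw [← hs0]
    calc ((c.factorial : ℕ) : ℕ∞) < ((c.factorial + 1 : ℕ) : ℕ∞) := by rw [Nat.cast_lt]; omega
      _ = 1 + ((c.factorial : ℕ) : ℕ∞) := by rw [Nat.cast_add, Nat.cast_one, add_comm]
      _ ≤ sFlag q T E' 0 + ((c.factorial : ℕ) : ℕ∞) := add_le_add h1le le_rfl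

/-! ### All residual orders at once (the child non-terminal) -/

/-- **DropZeroStatement, child flag `V(z₁, y + g(x))` (`n = 0`, first orientation), EVERY `d_res(B)`**: `d_res ≥ q` by the hidden-monomial
file (p509083), `0 < d_res < q` by the companion branch, `d_res = 0` impossible for a non-terminal child. Witness `X·g`.
[HP24 Prop. 4 (i) pp. 794–795] -/
theorem exists_flag_gt_of_isN0_stepZero_all (p : ℕ) [Fact p.Prime] [CharP k p] {e : ℕ} {B T : MvPowerSeries (Fin 2) k}
    (hB : cleanSeries (p ^ e) B = B) (hB0 : B ≠ 0) (hqo : ((p ^ e : ℕ) : ℕ∞) ≤ B.order)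
    (hT : (X 0 : MvPowerSeries (Fin 2) k) ^ (p ^ e) * T = subst (PlaneGerm.dirChart (0 : k)) B) {E E' : Finset (Fin 2)}
    (h0 : (0 : Fin 2) ∈ E') (h1 : (1 : Fin 2) ∈ E' ↔ (1 : Fin 2) ∈ E) (hntT : ¬ TermSub (p ^ e) T)
    (g : PowerSeries k) (hg : PowerSeries.constantCoeff g = 0) (hN : IsN0 E' g) :
    ∃ f : PowerSeries k, PowerSeries.constantCoeff f = 0 ∧ (IsN0 E f ∨ IsTangent E f) ∧
      flagTriple (p ^ e) T E' g < flagTriple (p ^ e) B E f := by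
  by_cases hq : p ^ e ≤ dRes B E
  · exact exists_flag_gt_of_isN0_stepZero p hB hB0 hqo hT h0 h1 hq hntT g hg hN
  · by_cases hd0 : 0 < dRes B E
    · exact exists_flag_gt_of_isN0_stepZero_lt (p ^ e) hB hB0 hqo hT h0 h1 hd0 (by omega) g hg hN
    · exfalso
      have hd' : dRes T E' = 0 := by have := dRes_stepZero_le (p ^ e) hB0 hqo hT h0 h1; omega
      exact hntT (termSub_of_dRes_eq_zero E' (ne_zero_stepZero (p ^ e) hB0 hT) (cleanSeries_of_stepZero (p ^ e) hB hT) hd')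

/-- **DropZeroStatement, child flag `V(z₁, x)` (`n = 0`, second orientation), EVERY `d_res(B)`** (`q ≥ 1`). Witness the zero shift.
[HP24 Prop. 4 (i) pp. 794–795] -/
theorem exists_flag_gt_of_isN0_swap_stepZero_all (q : ℕ) (hq1 : 1 ≤ q) {B T : MvPowerSeries (Fin 2) k}
    (hB : cleanSeries q B = B) (hB0 : B ≠ 0) (hqo : ((q : ℕ) : ℕ∞) ≤ B.order)
    (hT : (X 0 : MvPowerSeries (Fin 2) k) ^ q * T = subst (PlaneGerm.dirChart (0 : k)) B) {E E' : Finset (Fin 2)}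
    (h0 : (0 : Fin 2) ∈ E') (h1 : (1 : Fin 2) ∈ E' ↔ (1 : Fin 2) ∈ E) (hntT : ¬ TermSub q T)
    (g : PowerSeries k) (hN : IsN0 (swapE E') g) :
    ∃ f : PowerSeries k, PowerSeries.constantCoeff f = 0 ∧ (IsN0 E f ∨ IsTangent E f) ∧
      flagTriple q (swap T) (swapE E') g < flagTriple q B E f := by
  by_cases hq : q ≤ dRes B E
  · exact exists_flag_gt_of_isN0_swap_stepZero q hq1 hB hB0 hqo hT h0 h1 hq g hN
  · by_cases hd0 : 0 < dRes B E
    · exact exists_flag_gt_of_isN0_swap_stepZero_lt q hB hB0 hqo hT h0 h1 hd0 (by omega) g hN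
    · exfalso
      have hd' : dRes T E' = 0 := by have := dRes_stepZero_le q hB0 hqo hT h0 h1; omega
      exact hntT (termSub_of_dRes_eq_zero E' (ne_zero_stepZero q hB0 hT) (cleanSeries_of_stepZero q hB hT) hd')

/-! ### The hypotheses `(hγ₁)`, `(hγ₂)` of `dropZeroStatement_of_pieces`, discharged -/

/-- **`(hγ₁)` of `dropZeroStatement_of_pieces` holds**: first orientation, `n = 0` child flags, parent `d_res < q`. -/
theorem dropZero_hγ₁ (p : ℕ) [Fact p.Prime] [CharP k p] (e : ℕ) :
    ∀ (B : MvPowerSeries (Fin 2) k) (E : Finset (Fin 2)) (T : MvPowerSeries (Fin 2) k),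
      cleanSeries (p ^ e) B = B → B ≠ 0 → ((p ^ e : ℕ) : ℕ∞) < B.order →
      X 0 ^ (p ^ e) * T = subst (PlaneGerm.dirChart (0 : k)) B →
      ((p ^ e : ℕ) : ℕ∞) < T.order → ¬ TermSub (p ^ e) T → dRes B E < p ^ e →
      ∀ g : PowerSeries k, PowerSeries.constantCoeff g = 0 → IsN0 (succE (0 : k) E) g →
        ∃ f : PowerSeries k, PowerSeries.constantCoeff f = 0 ∧ (IsN0 E f ∨ IsTangent E f) ∧
          flagTriple (p ^ e) T (succE (0 : k) E) g < flagTriple (p ^ e) B E f :=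
  fun _ E _ hB hB0 hBord hT _ hnT _ g hg hN =>
    exists_flag_gt_of_isN0_stepZero_all p hB hB0 hBord.le hT (zero_mem_succE_zero E) (one_mem_succE_zero_iff E) hnT g hg hN

/-- **`(hγ₂)` of `dropZeroStatement_of_pieces` holds**: second orientation, `n = 0` child flags, parent `d_res < q`. -/
theorem dropZero_hγ₂ (p : ℕ) [Fact p.Prime] [CharP k p] (e : ℕ) :
    ∀ (B : MvPowerSeries (Fin 2) k) (E : Finset (Fin 2)) (T : MvPowerSeries (Fin 2) k),
      cleanSeries (p ^ e) B = B → B ≠ 0 → ((p ^ e : ℕ) : ℕ∞) < B.order →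
      X 0 ^ (p ^ e) * T = subst (PlaneGerm.dirChart (0 : k)) B →
      ((p ^ e : ℕ) : ℕ∞) < T.order → ¬ TermSub (p ^ e) T → dRes B E < p ^ e →
      ∀ g : PowerSeries k, PowerSeries.constantCoeff g = 0 → IsN0 (swapE (succE (0 : k) E)) g →
        ∃ f : PowerSeries k, PowerSeries.constantCoeff f = 0 ∧ (IsN0 E f ∨ IsTangent E f) ∧
          flagTriple (p ^ e) (swap T) (swapE (succE (0 : k) E)) g < flagTriple (p ^ e) B E f :=
  fun _ E _ hB hB0 hBord hT _ hnT _ g _ hN =>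
    exists_flag_gt_of_isN0_swap_stepZero_all (p ^ e) (Nat.one_le_pow _ _ (Fact.out : p.Prime).pos) hB hB0 hBord.le hT
      (zero_mem_succE_zero E) (one_mem_succE_zero_iff E) hnT g hN

/-- **`DropZeroStatement` modulo the single piece `(iv₀)`** ([HP24, Prop. 4 (iv)] at `t = 0`: second-orientation tangent child flags of
tangency `≥ 2`): all `n = 0` flags of both orientations (this chain of files), the first-orientation tangent flags ((iii), p509083) and
the tangency-`1` second-orientation flags (InvN1, p509658) are in the tree; res-L1-w43-stub-1's `dropZeroStatement_of_pieces` assembles. -/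
theorem dropZeroStatement_of_iv (p : ℕ) [Fact p.Prime] (k : Type) [Field k] [CharP k p] (e : ℕ)
    (hiv : ∀ (B : MvPowerSeries (Fin 2) k) (E : Finset (Fin 2)) (T : MvPowerSeries (Fin 2) k),
      cleanSeries (p ^ e) B = B → B ≠ 0 → ((p ^ e : ℕ) : ℕ∞) < B.order →
      X 0 ^ (p ^ e) * T = subst (PlaneGerm.dirChart (0 : k)) B →
      ((p ^ e : ℕ) : ℕ∞) < T.order → ¬ TermSub (p ^ e) T →
      ∀ g : PowerSeries k, PowerSeries.constantCoeff g = 0 → IsTangent (swapE (succE (0 : k) E)) g → 2 ≤ tangency g →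
        ∃ f : PowerSeries k, PowerSeries.constantCoeff f = 0 ∧ (IsN0 E f ∨ IsTangent E f) ∧
          flagTriple (p ^ e) (swap T) (swapE (succE (0 : k) E)) g < flagTriple (p ^ e) B E f) :
    DropZeroStatement p e k :=
  dropZeroStatement_of_pieces p k e (dropZero_hγ₁ p e) (dropZero_hγ₂ p e) hiv

end PurePowerFlag

end Summit.ResolutionOfSingularities.ResolutionOfSingularities.Theorems
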